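import Summits.CriticalPhenomena.Ising3DConformalLimit.Theses.GaussianScaleMixture

/-!
# `stub_arccosQuarter` of line `two-crystals-generate-so3` (crux `RotationUpgradeFromTwoPoint`,
stmt-CriticalPhenomena-8367) — kernel-checked verification by the deep-refute seat

Statement copied VERBATIM from `Cruxes/RotationUpgradeFromTwoPoint/Lines/two-crystals-generate-so3.lean`
(gen 2). Proof: the integer sequence `a 0 = 2, a 1 = -1, a (n+2) = -a (n+1) - 4 a n` satisfies
`a n = 2^(n+1) cos (n θ₀)` (`cos θ₀ = -1/4`, Chebyshev recurrence) and is odd from `n = 1` on, so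
`cos (n θ₀) ≠ 1` for `n ≥ 1`; but `m θ₀ = 2πk`, `m ≠ 0` gives `cos (|m| θ₀) = 1`.
Candidate proof for the worker holding the stub (refuters do not land positive statements).
-/

noncomputable section

namespace Summit.CriticalPhenomena.Ising3DConformalLimit.Cruxes.RotationUpgradeFromTwoPoint.DrefuteTwoCrystals

/-- The 2-adic bookkeeping sequence `aₙ = 2ⁿ⁺¹ cos (n θ₀)`. [folklore] -/
def aseq : ℕ → ℤ
  | 0 => 2
  | 1 => -1
  | (n + 2) => -aseq (n + 1) - 4 * aseq n

/-- `aₙ` is odd for `n ≥ 1`. [folklore] -/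
theorem aseq_succ_odd : ∀ n, Odd (aseq (n + 1))
  | 0 => ⟨-1, by simp [aseq]⟩
  | (n + 1) => by
      obtain ⟨t, ht⟩ := aseq_succ_odd n
      refine ⟨-t - 1 - 2 * aseq n, ?_⟩
      show -aseq (n + 1) - 4 * aseq n = _
      rw [ht]; ring

/-- `aₙ = 2ⁿ⁺¹ cos (n θ₀)` with `θ₀ = arccos (-1/4)`. [folklore] -/
theorem aseq_eq : ∀ n : ℕ,
    (aseq n : ℝ) = 2 ^ (n + 1) * Real.cos (n * Real.arccos (-1 / 4))
  | 0 => by simp [aseq]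
  | 1 => by
      rw [Nat.cast_one, one_mul, Real.cos_arccos (by norm_num) (by norm_num)]
      simp [aseq]; norm_num
  | (n + 2) => by
      set θ := Real.arccos (-1 / 4) with hθ
      have hcos : Real.cos θ = -1 / 4 := Real.cos_arccos (by norm_num) (by norm_num)
      have h0 := aseq_eq n
      have h1 := aseq_eq (n + 1)
      rw [← hθ] at h0 h1
      have key : Real.cos (((n + 2 : ℕ) : ℝ) * θ) =
          2 * Real.cos θ * Real.cos (((n + 1 : ℕ) : ℝ) * θ) - Real.cos ((n : ℝ) * θ) := by
        have e1 : ((n + 2 : ℕ) : ℝ) * θ = ((n + 1 : ℕ) : ℝ) * θ + θ := by push_cast; ring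
        have e2 : (n : ℝ) * θ = ((n + 1 : ℕ) : ℝ) * θ - θ := by push_cast; ring
        rw [e1, e2, Real.cos_add, Real.cos_sub]; ring
      have hrec : (aseq (n + 2) : ℝ) = -(aseq (n + 1) : ℝ) - 4 * (aseq n : ℝ) := by
        show ((-aseq (n + 1) - 4 * aseq n : ℤ) : ℝ) = _
        push_cast; ring
      rw [hrec, h0, h1, key, hcos]
      ring

/-- **`stub_arccosQuarter`** (verbatim): `m · arccos(-1/4) ∉ 2πℤ` for `m ≠ 0`. [folklore] -/
theorem arccosQuarter_holds :
    ∀ m k : ℤ, m ≠ 0 → (m : ℝ) * Real.arccos (-1 / 4) ≠ (k : ℝ) * (2 * Real.pi) := by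
  intro m k hm heq
  set θ := Real.arccos (-1 / 4) with hθ
  -- `cos (m θ₀) = 1`
  have hcosm : Real.cos ((m : ℝ) * θ) = 1 := by
    rw [heq]; exact Real.cos_int_mul_two_pi k
  -- pass to `n = |m| ≥ 1`
  set n : ℕ := m.natAbs with hn
  have hn1 : n ≠ 0 := Int.natAbs_ne_zero.2 hm
  have hθnn : 0 ≤ θ := Real.arccos_nonneg _
  have hcosn : Real.cos ((n : ℝ) * θ) = 1 := by
    rw [hn, Nat.cast_natAbs, Int.cast_abs, ← abs_of_nonneg hθnn, ← abs_mul, Real.cos_abs, hcosm]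
  -- `a n = 2^(n+1)` contradicts oddness
  have ha : (aseq n : ℝ) = 2 ^ (n + 1) := by rw [aseq_eq n, hcosn, mul_one]
  have ha' : aseq n = 2 ^ (n + 1) := by exact_mod_cast ha
  obtain ⟨j, hj⟩ : ∃ j, n = j + 1 := Nat.exists_eq_succ_of_ne_zero hn1
  rw [hj] at ha'
  have hodd := aseq_succ_odd j
  rw [ha'] at hodd
  have heven : Even ((2 : ℤ) ^ (j + 1 + 1)) := (Int.even_pow' (by omega)).2 (by decide)
  exact (Int.not_even_iff_odd.2 hodd) heven

end Summit.CriticalPhenomena.Ising3DConformalLimit.Cruxes.RotationUpgradeFromTwoPoint.DrefuteTwoCrystals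

end
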